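import Summits.AtomisticToContinuum.FouriersLaw.Theorems.BondHeatUncertaintyExtensiveSnapshotIrreversibilityEnergyWindowDilationDepartureA

/-!
(SPLIT FOR THE 400-LINE CAP by the landing lane, hand-2 g33: this file = part 1 of 2; sequels `…BondHeatUncertaintyExtensiveSnapshotIrreversibilityEnergyWindowDilationArrivalA` import it in a chain; same namespace, all FQNs unchanged.)
# Bond heat uncertainty — node «DilationArrival», part X-2A: truncation, orbit growth and the
  two integrations by parts against the density

Cell `decomp-a2c`, lens «grading / quantitative ladder», generation 87, part X-2 (first of two
files; the theorems (EBᵃ)/(XBᶠ) and the junctions are in `…EnergyWindowDilationArrival`).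

The ARRIVAL side of the dilation Duhamel (part W) moves the derivatives of the observable onto
the ARRIVAL variable of the transition density `p(s, z, ·)`; this file supplies the pieces.

* §1 Calculus: `∂_{p_b}` of a function of the positions and `∂_{q_b} p_j` vanish (the exchange
  field `p_b ∂_{q_b} + (∂_{q_b}H) ∂_{p_b}` is divergence-free), pointwise product rule and the
  scaled cutoff `χ_R` in the position direction (`|∂_{q_b} χ_R| ≤ K/R`).
* §2 The two-temperature orbit `u = P^δ_t h`: `P^δ_0 h = h`; `u ∈ C^∞` for `h ∈ C_c^∞`, `t ≥ 0`
  (differentiation under `∫ h(y) p(t,·,y) dy`, the equal-temperature argument of part HessianSplitA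
  verbatim with the two-temperature density); the CEHR growth `|u| ≤ e^{2γTθ} e^{θH}`.
* §3 The CEHR (3.4) root bound with a constant: `(∫ |G|^r p(t,w,·))^{1/r} ≤ K e^{θγ(T_L+T_R)}
  e^{θH(w)}` for `|G| ≤ K e^{θH}`.
* §4 Integration by parts against a `C¹` weight `f` (later `f = p(s,z,·)`), no boundary terms
  (compact support): the dilation identity `∫ f · p_b ∂_{p_b}h = −∫ h f − ∫ (h p_b) ∂_{p_b} f`
  and the truncated exchange identity
  `∫ f χ (p_b ∂_{q_b}u + a(q) ∂_{p_b}u) = −∫ u f (p_b ∂_{q_b}χ + a ∂_{p_b}χ) − ∫ (χ u p_b) ∂_{q_b} f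
   − ∫ (χ u a) ∂_{p_b} f` (Mathlib's `integral_mul_fderiv_eq_neg_fderiv_mul_of_integrable`).

[cite: CuneoEckmannHairerReyBellet2018, §3 eq. (3.2)–(3.4), Prop. 3.2]
-/

noncomputable section

namespace Summit.AtomisticToContinuum.FouriersLaw.Theorems.ExtensiveSnapshotIrreversibility.EnergyWindow

open MeasureTheory Filter Topology Real Set Metric
open scoped ENNReal NNReal ContDiff
open Literature.MathematicalPhysics.KineticTheory.HeatConduction Literature.Probability.Process
open Literature.Analysis.FunctionSpaces

variable {N : ℕ}

/-! ## 1. Calculus: divergence-free coefficients, product rule, the cutoff in direction `e_{q_b}` -/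

section Calculus

/-- `∂_{p_b}` of a function of the positions only vanishes (lambda form `fun y => g y.1`, as it
occurs in the exchange field below; the composition form `g ∘ Prod.fst` is the tree's
`HeatConduction.partialP_comp_fst` in `MomentumHermiteLadder`, not imported here). [folklore] -/
theorem partialP_fun_fst_eq_zero (b : Fin N) (g : (Fin N → ℝ) → ℝ) (x : PhaseSpace N) :
    partialP b (fun y : PhaseSpace N => g y.1) x = 0 := by
  simp [partialP]

/-- `∂_{q_b} p_j = 0`. [folklore] -/
theorem partialQ_momentum_coord (b j : Fin N) (x : PhaseSpace N) :
    partialQ b (fun y : PhaseSpace N => y.2 j) x = 0 := by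
  simp [partialQ]

/-- `∂_{q_b} f(w) = Df(w)(e_b, 0)` for `f` differentiable at `w` (pointwise form of
`partialQ_eq_fderiv`, via `partialQ_eq_lineDeriv`). [folklore] -/
theorem partialQ_eq_fderiv_apply (b : Fin N) {f : PhaseSpace N → ℝ} {w : PhaseSpace N}
    (hf : DifferentiableAt ℝ f w) :
    partialQ b f w = fderiv ℝ f w ((Pi.single b 1, 0) : PhaseSpace N) := by
  rw [partialQ_eq_lineDeriv, hf.lineDeriv_eq_fderiv]

/-- **Product rule** `∂_{q_b}(fg) = f ∂_{q_b} g + g ∂_{q_b} f`, pointwise `fun`-form (the position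
twin of `partialP_fun_mul`). [folklore] -/
theorem partialQ_fun_mul (b : Fin N) {f g : PhaseSpace N → ℝ} {w : PhaseSpace N}
    (hf : DifferentiableAt ℝ f w) (hg : DifferentiableAt ℝ g w) :
    partialQ b (fun y => f y * g y) w = f w * partialQ b g w + g w * partialQ b f w := by
  have hfg : DifferentiableAt ℝ (fun y => f y * g y) w := hf.mul hg
  rw [partialQ_eq_fderiv_apply b hfg, partialQ_eq_fderiv_apply b hf,
    partialQ_eq_fderiv_apply b hg, fderiv_fun_mul hf hg]
  rfl

/-- `|∂_{q_b} χ_R| ≤ K/R` (the position twin of `abs_partialP_ewCutoff_le`). [folklore] -/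
theorem abs_partialQ_ewCutoff_le {b : Fin N} {K : ℝ}
    (hK : ∀ w : PhaseSpace N, |fderiv ℝ (ewBump N) w ((Pi.single b 1, 0) : PhaseSpace N)| ≤ K)
    {R : ℝ} (hR : 0 < R) (w : PhaseSpace N) : |partialQ b (ewCutoff N R) w| ≤ K / R := by
  rw [partialQ_eq_fderiv_apply b (((ewCutoff_contDiff (n := 1) R).differentiable (by simp)) w),
    fderiv_ewCutoff_apply, abs_mul, abs_inv, abs_of_pos hR, div_eq_inv_mul]
  exact mul_le_mul_of_nonneg_left (hK _) (inv_nonneg.2 hR.le)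

end Calculus

/-! ## 2. The two-temperature orbit `P^δ_t h`: `t = 0`, smoothness, growth -/

section Orbit

variable {ω₂ lam β γ : ℝ} {T_L T_R : ℝ} {p : ℝ → PhaseSpace N → PhaseSpace N → ℝ}

/-- **`u_t = ∫ h(y) p(t,·,y) dy` is smooth** for `h ∈ C_c^∞`, `t > 0` and a jointly smooth
transition density `p` (ANY bath temperatures): differentiation under the integral sign to all
orders with local domination on `tsupport h × B̄(w₀, 1)` — the argument of
`contDiff_eqKernelFun` (part HessianSplitA, equal temperatures) verbatim. [folklore] -/
theorem contDiff_integral_mul_density (hp : IsTransitionDensity ω₂ lam β γ N T_L T_R p)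
    {h : PhaseSpace N → ℝ} (hh : ContDiff ℝ ∞ h) (hhc : HasCompactSupport h) {t : ℝ}
    (ht : 0 < t) : ContDiff ℝ ∞ fun w => ∫ y, h y * p t w y := by
  have hG : ContDiff ℝ ∞ fun v : PhaseSpace N × PhaseSpace N => h v.1 * p t v.2 v.1 := by
    have h1 : ContDiff ℝ ∞ fun v : PhaseSpace N × PhaseSpace N => p t v.2 v.1 :=
      (hp.contDiff_uncurry_top ht).comp (contDiff_snd.prodMk contDiff_fst)
    exact (hh.comp contDiff_fst).mul h1
  have hJ : ∀ m : ℕ, Continuous fun q : PhaseSpace N × PhaseSpace N =>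
      iteratedFDeriv ℝ m (fun w : PhaseSpace N => h q.1 * p t w q.1) q.2 := fun m =>
    (contDiff_iteratedFDeriv_section_right hG m).continuous
  refine contDiffOn_univ.1 (contDiffOn_integral_of_dominated
    (μ := (volume : Measure (PhaseSpace N))) (f := fun w y => h y * p t w y) isOpen_univ
    (Eventually.of_forall fun y => (hG.comp (contDiff_prodMk_right y)).contDiffOn)
    (fun m w _ => ((hJ m).comp (continuous_id.prodMk continuous_const)).aestronglyMeasurable)
    fun m w₀ _ => ?_)
  obtain ⟨C₀, hC₀⟩ := (hhc.isCompact.prod (isCompact_closedBall w₀ 1)).exists_bound_of_continuousOn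
    (hJ m).continuousOn
  have hKm : MeasurableSet (tsupport h) := (isClosed_tsupport h).measurableSet
  refine ⟨1, one_pos, (tsupport h).indicator fun _ => max C₀ 0, ?_,
    Eventually.of_forall fun y w hw => ?_⟩
  · rw [integrable_indicator_iff hKm]
    exact integrableOn_const (hhc.isCompact.measure_lt_top).ne
  · by_cases hy : y ∈ tsupport h
    · rw [Set.indicator_of_mem hy]
      exact (hC₀ (y, w) ⟨hy, ball_subset_closedBall hw⟩).trans (le_max_left _ _)
    · have h0 : (fun w : PhaseSpace N => h y * p t w y) = fun _ => 0 := by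
        funext w
        rw [image_eq_zero_of_notMem_tsupport hy, zero_mul]
      rw [Set.indicator_of_notMem hy, h0, iteratedFDeriv_fun_zero, Pi.zero_apply, norm_zero]

/-- **`P^δ_0 h = h`** (`P_0 = id`). [folklore] -/
theorem pertKernelFun_zero (hω : 0 < ω₂) (hl : 0 ≤ lam) (hβ : 0 ≤ β) (hγ : 0 ≤ γ) (T δ : ℝ)
    (N : ℕ) (h : PhaseSpace N → ℝ) : pertKernelFun ω₂ lam β γ T δ N h 0 = h := by
  funext w
  simp only [pertKernelFun, pertKernel, Real.toNNReal_zero]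
  rw [pinnedChain_transitionKernel_zero hω hl hβ hγ N (T + δ / 2) (T - δ / 2),
    ProbabilityTheory.Kernel.id_apply, integral_dirac]

/-- **Two-temperature orbit smoothness (the (R2^δ) of the g86 plan, as a theorem)**: for a
transition density `p` of the `δ`-chain, `h ∈ C_c^∞` and `t ≥ 0`, `P^δ_t h ∈ C^∞`. [folklore] -/
theorem contDiff_pertKernelFun (hω : 0 < ω₂) (hl : 0 ≤ lam) (hβ : 0 ≤ β) (hγ : 0 ≤ γ) {T δ : ℝ}
    (hp : IsTransitionDensity ω₂ lam β γ N (T + δ / 2) (T - δ / 2) p) {h : PhaseSpace N → ℝ}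
    (hh : ContDiff ℝ ∞ h) (hhc : HasCompactSupport h) {t : ℝ} (ht : 0 ≤ t) :
    ContDiff ℝ ∞ (pertKernelFun ω₂ lam β γ T δ N h t) := by
  rcases ht.eq_or_lt with h0 | h0
  · rw [← h0, pertKernelFun_zero hω hl hβ hγ T δ N h]
    exact hh
  · rw [pertKernelFun_eq_integral_mul_density hp h0 h]
    exact contDiff_integral_mul_density hp hh hhc h0

/-- **CEHR growth of the orbit**: `|P^δ_t h (w)| ≤ e^{2γTθ} e^{θH(w)}` for `|h| ≤ e^{θH}`
measurable, `0 ≤ t ≤ 1`, `θ < 1/max(T ± δ/2)` (CEHR (3.4) from `w`, `T_L + T_R = 2T`).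
[cite: CuneoEckmannHairerReyBellet2018, §3 eq. (3.4)] -/
theorem abs_pertKernelFun_le (hω : 0 < ω₂) (hl : 0 < lam) (hβ : 0 < β) (hγ : 0 < γ)
    (hN0 : 0 < N) {T δ : ℝ} (hT : 0 < T) (hL : 0 < T + δ / 2) (hR : 0 < T - δ / 2) {θ : ℝ}
    (hθ : 0 < θ) (hθm : θ < 1 / max (T + δ / 2) (T - δ / 2)) {h : PhaseSpace N → ℝ}
    (hhm : Measurable h)
    (hhθ : ∀ y, |h y| ≤ Real.exp (θ * (pinnedChain ω₂ lam β γ).hamiltonian N y)) {t : ℝ}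
    (ht0 : 0 ≤ t) (ht1 : t ≤ 1) (w : PhaseSpace N) :
    |pertKernelFun ω₂ lam β γ T δ N h t w| ≤
      Real.exp (θ * γ * (T + T)) * Real.exp (θ * (pinnedChain ω₂ lam β γ).hamiltonian N w) := by
  obtain ⟨-, hb⟩ := integrable_and_abs_integral_transitionKernel_le hω hl hβ hγ hN0 hL hR hθ hθm
    t.toNNReal w zero_le_one hhm (fun y => by rw [one_mul]; exact hhθ y)
  have h2T : T + δ / 2 + (T - δ / 2) = T + T := by ring
  simp only [one_mul, Real.coe_toNNReal _ ht0, h2T] at hb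
  refine hb.trans (mul_le_mul_of_nonneg_right (Real.exp_le_exp.2 ?_) (Real.exp_pos _).le)
  exact mul_le_of_le_one_right (by positivity) ht1

end Orbit

/-! ## 3. The CEHR (3.4) root bound with a constant -/

section Root

variable {ω₂ lam β γ : ℝ} {T_L T_R : ℝ} {p : ℝ → PhaseSpace N → PhaseSpace N → ℝ}

/-- **Root bound with a constant**: for `|G| ≤ K e^{θH}` (`K ≥ 0`), `1 < r`,
`rθ < 1/max(T_L,T_R)`, `0 < t ≤ 1`:
`(∫ |G(y)|^r p(t,w,y) dy)^{1/r} ≤ K e^{θγ(T_L+T_R)} e^{θH(w)}` (from the case `K = 1`,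
`rpow_integral_abs_rpow_mul_density_le`, applied to `G/K`).
[cite: CuneoEckmannHairerReyBellet2018, §3 eq. (3.4)] -/
theorem rpow_integral_abs_rpow_mul_density_le_of_le_mul (hω : 0 < ω₂) (hl : 0 < lam)
    (hβ : 0 < β) (hγ : 0 < γ) (hN0 : 0 < N) (hL : 0 < T_L) (hR : 0 < T_R) {θ r : ℝ} (hθ : 0 < θ)
    (hr : 1 < r) (hθr : r * θ < 1 / max T_L T_R) (hp : IsTransitionDensity ω₂ lam β γ N T_L T_R p)
    {t : ℝ} (ht0 : 0 < t) (ht1 : t ≤ 1) (w : PhaseSpace N) {G : PhaseSpace N → ℝ} {K : ℝ}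
    (hK : 0 ≤ K)
    (hG : ∀ y, |G y| ≤ K * Real.exp (θ * (pinnedChain ω₂ lam β γ).hamiltonian N y)) :
    (∫ y, |G y| ^ r * p t w y) ^ (1 / r) ≤
      K * (Real.exp (θ * γ * (T_L + T_R)) *
        Real.exp (θ * (pinnedChain ω₂ lam β γ).hamiltonian N w)) := by
  have hr0 : 0 < r := one_pos.trans hr
  rcases hK.eq_or_lt with hK0 | hKpos
  · -- `K = 0`: `G = 0`
    have hG0 : ∀ y, |G y| ^ r * p t w y = 0 := fun y => by
      have h0 : |G y| = 0 :=
        le_antisymm ((hG y).trans_eq (by rw [← hK0, zero_mul])) (abs_nonneg _)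
      rw [h0, Real.zero_rpow hr0.ne', zero_mul]
    simp only [hG0, integral_zero, ← hK0, zero_mul]
    rw [Real.zero_rpow (one_div_pos.2 hr0).ne']
  · -- `K > 0`: scale
    have hG' : ∀ y, |G y / K| ≤ Real.exp (θ * (pinnedChain ω₂ lam β γ).hamiltonian N y) :=
      fun y => by
        rw [abs_div, abs_of_pos hKpos, div_le_iff₀ hKpos, mul_comm]
        exact hG y
    have h1 := rpow_integral_abs_rpow_mul_density_le hω hl hβ hγ hN0 hL hR hθ hr hθr hp ht0 ht1
      w hG'
    have hKr : 0 < K ^ r := Real.rpow_pos_of_pos hKpos r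
    have e : ∫ y, |G y| ^ r * p t w y = K ^ r * ∫ y, |G y / K| ^ r * p t w y := by
      rw [← integral_const_mul]
      refine integral_congr_ae (ae_of_all _ fun y => ?_)
      dsimp only
      rw [abs_div, abs_of_pos hKpos, Real.div_rpow (abs_nonneg _) hKpos.le]
      field_simp
    have hI0 : 0 ≤ ∫ y, |G y / K| ^ r * p t w y :=
      integral_nonneg fun y => mul_nonneg (Real.rpow_nonneg (abs_nonneg _) _) (hp.2.1 t ht0 w y)
    rw [e, Real.mul_rpow hKr.le hI0, ← Real.rpow_mul hKpos.le, mul_one_div_cancel hr0.ne',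
      Real.rpow_one]
    exact mul_le_mul_of_nonneg_left h1 hKpos.le

end Root

end Summit.AtomisticToContinuum.FouriersLaw.Theorems.ExtensiveSnapshotIrreversibility.EnergyWindow

end
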